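import Summits.Ventures.HodgeRepro2.T6N41PlaceKappaMain
import Summits.Ventures.HodgeRepro2.T6N42ToyNSide

/-!
# T6PeriodInputToy2Place — the placement chain (P7) + (A″κ) on the JOINT TOY's N4 datum `toyD41` (the v7 witness
seam; Tier 6, M2; definition lane; seat t6-p6, the (γ) assembly lineage)

Cell pub-hodge-repro2, Tier 6 (README §10), seat t6-p6. Count-neutral glue for the §10.5(ii)(d) witness of a v7
M2 object (t6-lead's plan of record STATUS l. 11672 (c)). t6-p4's drop-in
(route/t6-p4-lean/T6PeriodInput6PlacedTau.staged.lean) replaces v6's residual `hunr` per side by the placement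
lane's fourteen binders — the data `Pl : PlacementDatum M.sA.d41`, `In : InertDatum Pl`, `Sp : SplitDatum In`,
`LQ : SplitLQ Sp`, `Kd : KappaDatum Sp` (T6N41Place / PlaceInert / PlaceSplit / PlaceSplitLQ / PlaceKappa), the
seven displays `LapidRallis2005_Sec7_Unramified`, `Bump1997_5_22`, `HarrisII2007_Prop2_2_5_b`,
`Rogawski1990_Sec11_4_BC`, `Minguez2008_Thm1_2_LQ`, `Bump1997_Thm4_5_1`, `Rao1993_CorA5_1`, the dichotomy `hdich`
and the residual `hκ'` — consumed by `N41Place.N41_placement_kappa`. t6-p4's own witnesses (T6N41PlaceToy /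
PlaceInertToy / PlaceSplitToy / PlaceKappaToy) live on t6-p4's toy doubling data `toyDatum` (`ι = Unit`) and
`toyDatumIS` (`ι = Bool`, `S = ∅`: every display non-vacuous there); the joint toy v2's N4 datum is t6-p5's
`toyD41 : DoublingLDatum ToyPlace` (T6N42ToyNSide; `S = Finset.univ`). This file supplies the chain on `toyD41`:
* `pl : PlacementDatum toyD41` — primes = the places themselves (`κ = ToyPlace`, `b = id`), `N = 2`, Satake
  parameters as the model (`RepGL = ℂˣ × ℂˣ`, `ps = Prod.mk`), Bump's `(5.22)` as the definition of `LGL`, all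
  Satake parameters and Hecke values `1`, `LGLv` the fibre product by definition; the `off S` fields vacuous;
* `inert : InertDatum pl` with NO inert prime (`inert 𝔓 := False`): `RepU = ℂˣ × ℂˣ`, `twist`, `ps_inj` as the
  model, `thetaLift := True`; every inert-conditioned field vacuous;
* `split : SplitDatum inert` with NO split place (`splitPlace v := False`): `psF = Prod.mk`, `twistF`, `ωc` the
  product, `ι₁ = id`, `ι₂` the componentwise inverse — the structural identities by `rfl`, the split-conditioned
  fields vacuous; `lq : SplitLQ split` (`LQ = Prod.mk`); `kd : KappaDatum split` (the trivial Weil-index model: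
  `γF = hilbert = 1`, so Rao's Cor. A.5(1) is `1 = 1 · 1`);
* the seven displays, `hdich` and `hκ'` as THEOREMS: Bump (5.22) and Rao Cor. A.5(1) by the model (unconditional
  identities), the other five and `hdich` / `hκ'` VACUOUS on `toyD41` (`S` = every place; no inert prime, no
  split place) — exactly as v6's `toyD41_hunr` (`∀ v ∉ toyD41.S, …`) is vacuous on the same datum.
Non-vacuity of the displays themselves is t6-p4's record (T6N41PlaceSplitToy: each display non-vacuous on
`toyDatumIS`); this file witnesses only that the v7 binder set is JOINTLY SATISFIABLE on the joint toy, the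
§10.5(ii)(d) sentence. Nothing here is consumed by a declared M2 object. §8(d): uses an L-value-free
non-vanishing device: NO.
-/

namespace Summit.Ventures.HodgeRepro2.T6
namespace PeriodInputToy2Place

open N42ToyNSide

/-- a place of the toy is in `toyD41.S` (`S = Finset.univ`) -/
theorem mem_S (v : ToyPlace) : v ∈ toyD41.S := Finset.mem_univ v

/-- The placement datum on `toyD41`: the primes are the places themselves, `N(𝔓) = 2`, the Satake model
`RepGL = ℂˣ × ℂˣ`, `ps = Prod.mk`, Bump's `(5.22)` as the definition of the local `L`-factor, every Satake
parameter and Hecke value `1`, `LGLv` the fibre product by definition. -/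
@[reducible] noncomputable def pl : PlacementDatum toyD41 where
  κ := ToyPlace
  b := id
  fin := fun _ => Set.toFinite _
  N := fun _ => 2
  one_lt_N := fun _ => by norm_num
  RepGL := fun _ => ℂˣ × ℂˣ
  ps := fun _ a b => (a, b)
  LGL := fun _ p s => (1 - (p.1 : ℂ) * (2 : ℂ) ^ (-s))⁻¹ * (1 - (p.2 : ℂ) * (2 : ℂ) ^ (-s))⁻¹
  BCχ := fun _ => (1, 1)
  LGLv := fun v s => ∏ 𝔓 ∈ (Set.toFinite ((id : ToyPlace → ToyPlace) ⁻¹' {v})).toFinset,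
    (1 - ((1 : ℂˣ) : ℂ) * (2 : ℂ) ^ (-s))⁻¹ * (1 - ((1 : ℂˣ) : ℂ) * (2 : ℂ) ^ (-s))⁻¹
  LGLv_eq := fun _ => rfl
  α := fun _ => 1
  β := fun _ => 1
  BCχ_ps := fun 𝔓 h => (h (mem_S 𝔓)).elim
  η₁ := fun _ => 1
  η₂ := fun _ => 1
  g₁_eq := fun v h => (h (mem_S v)).elim
  g₂_eq := fun v h => (h (mem_S v)).elim

/-- The inert datum on `pl` with no inert prime: the Satake model for `U(W_v)`, the twist on parameters,
`thetaLift := True`. -/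
@[reducible] noncomputable def inert : InertDatum pl where
  inert := fun _ => False
  RepU := fun _ => ℂˣ × ℂˣ
  π := fun _ => (1, 1)
  JH := fun _ _ => Set.univ
  BCrog := fun _ p => p
  twist := fun _ p ξ => (p.1 * ξ, p.2 * ξ)
  twist_ps := fun _ _ _ _ => rfl
  ps_inj := fun _ _ _ _ _ h => Or.inl ⟨congrArg Prod.fst h, congrArg Prod.snd h⟩
  χHarris := fun _ => -1
  ξV := fun _ => 1
  γD := fun _ => 1
  ωt := fun _ => 1
  βTrivial := fun _ => True
  thetaLift := fun _ => True
  thetaLift_all := fun _ => trivial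
  βTrivial_of := fun _ h => h.elim
  χHarris_eq := fun _ h => h.elim
  ξV_eq := fun _ h => h.elim
  γD_eq := fun _ h => h.elim
  ωt_eq := fun _ h => h.elim
  η₂_def := fun _ h => h.elim
  η₁_def := fun _ h => h.elim
  BCχ_eq := fun _ h => h.elim

/-- The split datum on `inert` with no split place: `psF = Prod.mk`, the twist on parameters, the central
character the product, `ι₁ = id`, `ι₂` the componentwise inverse (the structural identities by `rfl`). -/
@[reducible] noncomputable def split : SplitDatum inert where
  splitPlace := fun _ => False
  p₁ := id
  p₂ := id
  b_p₁ := fun _ h => h.elim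
  b_p₂ := fun _ h => h.elim
  p₁_ne_p₂ := fun _ h => h.elim
  fiber_split := fun _ h => h.elim
  not_inert := fun _ h => h.elim
  psF := fun _ a b => (a, b)
  twistF := fun _ p ξ => (p.1 * ξ, p.2 * ξ)
  twistF_ps := fun _ _ _ _ => rfl
  ωc := fun _ p => p.1 * p.2
  ωc_ps := fun _ _ _ => rfl
  θII := fun _ β => (1, β⁻¹)
  Θ := fun _ β => (1, β⁻¹)
  βv := fun _ => 1
  βv_unit := fun _ h => h.elim
  π_Θ := fun _ h => h.elim
  μ₁ := fun _ => 1
  μ₂ := fun _ => 1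
  μ₁_unit := fun _ h => h.elim
  Θ_eq := fun _ h => h.elim
  ι₁ := fun _ p => p
  ι₂ := fun _ p => (p.1⁻¹, p.2⁻¹)
  ι₁_ps := fun _ _ _ => rfl
  ι₂_ps := fun _ _ _ => rfl
  BCχ_p₁ := fun _ h => h.elim
  BCχ_p₂ := fun _ h => h.elim
  ωt_p₁ := fun _ h => h.elim
  ωt_p₂ := fun _ h => h.elim
  γD_p₂ := fun _ h => h.elim
  η₂_def := fun _ h => h.elim
  η₁_def := fun _ h => h.elim

/-- The Langlands-quotient carrier on `split`: `LQ a b = (a, b)`. -/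
@[reducible] def lq : SplitLQ split where
  LQ := fun _ a b => (a, b)

/-- The convention-character carrier on `split`: the trivial Weil-index model (`Fx = AddCh = Unit`,
`hilbert = γF = 1`), `λ_D = κ_v = 1`. -/
@[reducible] def kd : KappaDatum split where
  Fx := fun _ => Unit
  AddCh := fun _ => Unit
  smul := fun _ _ _ => ()
  hilbert := fun _ _ _ => 1
  γF := fun _ _ _ => 1
  ϖ := fun _ => ()
  ψ := fun _ => ()
  t := fun _ => ()
  lam := fun _ => 1
  κv := fun _ => 1
  μ₂_eq := fun _ h => h.elim
  γD_def := fun _ h => h.elim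

/-! ## The seven displays, the dichotomy and the residual on the chain -/

/-- LR §7's unramified identity: vacuous on `toyD41` (`S` = every place). -/
theorem lr7 : Hyp.LapidRallis2005_Sec7_Unramified toyD41 pl := fun v h => (h (mem_S v)).elim

/-- Bump (5.22) holds by the model: the local `L`-factor of `π(α₁, α₂)` IS the product of the two Euler
factors. -/
theorem bump522 : Hyp.Bump1997_5_22 pl := fun _ _ _ => rfl

/-- Harris II (2.2.5)(b): vacuous (no inert prime). -/
theorem harris : Hyp.HarrisII2007_Prop2_2_5_b inert := fun _ h => h.elim

/-- Rogawski §11.4: vacuous (no inert prime). -/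
theorem rogawski : Hyp.Rogawski1990_Sec11_4_BC inert := fun _ h => h.elim

/-- Mínguez Thm 1 (2) in Langlands-quotient form: vacuous (no split place). -/
theorem minguez : Hyp.Minguez2008_Thm1_2_LQ lq := fun _ h => h.elim

/-- Bump Thm 4.5.1: vacuous (no split place). -/
theorem bump451 : Hyp.Bump1997_Thm4_5_1 lq := fun _ h => h.elim

/-- Rao Cor. A.5(1) holds by the model: `γ_F(a, cη) = (a, c) · γ_F(a, η)` reads `1 = 1 · 1`. -/
theorem rao : Hyp.Rao1993_CorA5_1 kd := fun _ _ _ _ => (one_mul _).symm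

/-- The dichotomy off `S`: vacuous on `toyD41`. -/
theorem dich : ∀ 𝔓, pl.b 𝔓 ∉ toyD41.S → inert.inert 𝔓 ∨ split.splitPlace (pl.b 𝔓) :=
  fun 𝔓 h => (h (mem_S 𝔓)).elim

/-- The residual `hκ'` (the local convention identity at split places off `S`): vacuous on `toyD41`. -/
theorem kappa' : ∀ v, split.splitPlace v → v ∉ toyD41.S → kd.κv v = (kd.κ' v)⁻¹ :=
  fun _ h => h.elim

/-- (d) the placement lane's main theorem fires on the chain (every binder a theorem on the toy). -/
theorem placement_kappa : ∀ v ∉ toyD41.S, ∀ s : ℂ, toyD41.Lv v s = toyD41.g₁ v s * toyD41.g₂ v s :=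
  N41Place.N41_placement_kappa toyD41 pl inert split lq kd lr7 bump522 harris rogawski minguez bump451 rao
    dich kappa'

end PeriodInputToy2Place
end Summit.Ventures.HodgeRepro2.T6
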